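import Literature.RingTheory.TightClosure.CartierModule
import Mathlib.RingTheory.Support
import Mathlib.RingTheory.Noetherian.Basic
import Mathlib.LinearAlgebra.Quotient.Basic
import HarnessLib

/-!
# Cartier modules: sub-quotients, the nilpotent part, the crystalline support

Topic: `Literature/RingTheory/TightClosure`. Continuation of `CartierModule.lean` (Blickle–Böckle
2011, §2.2 and §3.3), all PROVED:

* `restrict` / `quotient` — the Cartier structures on a Cartier submodule `N` and on `M ⧸ N`
  (kernels and cokernels in the abelian category of Cartier modules, Def. 2.1);
  `iterImage_quotient_map` (`C̄ⁿ` on `M/N` = `Cⁿ` followed by the projection),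
  `isNilpotent_quotient_iff : (M/N nilpotent) ↔ ∃ n, Cⁿ(M) ⊆ N` — so nilpotence of a sub-quotient
  `N/N'` of Cartier submodules `N' ≤ N` reads `∃ n, Cⁿ(N) ⊆ N'` (Def. 2.7, Rem. 2.16) —,
  `IsSurjective.quotient`;
* `IsNilpotentOn.sup`, `iterImage_add_eq_bot` — sums and extensions of nilpotents are nilpotent
  (Lemma 2.9 (proof), Lemma 2.11);
* `nil` — the sum `M_nil` of all nilpotent Cartier submodules; for Noetherian `M` it is itself
  nilpotent, so the LARGEST nilpotent Cartier submodule (`isNilpotentOn_nil`, Lemma 2.9 /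
  Prop. 2.12 (a)), and `M/M_nil` has no non-zero nilpotent Cartier submodule
  (`eq_bot_of_isNilpotentOn_quotient_nil`, Prop. 2.12 (b)); `kerIterate n` — the nilpotent Cartier
  submodules `Mₙ = {m | Cⁿ(R m) = 0}` of the footnote to Def. 2.7, with `M_nil = ⋃ₙ Mₙ`
  (`nil_eq_iSup_kerIterate`);
* `crysSupport` — the **crystalline support** `⋂ₙ Supp(Cⁿ(M))`: the primes `x` at which no iterated
  image `Cⁿ(M)` vanishes, i.e. — since `Cⁿ` commutes with localisation, `(Cⁿ M)_x = Cⁿ(M_x)`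
  (Lemma 2.3 and the proof of Prop. 2.14) — the `x` with `M_x` NOT nilpotent, which is Def. 3.15;
  `crysSupport_eq_support` (`= Supp M` when `C` is surjective, Lemma 3.16 (a)),
  `crysSupport_eq_of_stable` (`= Supp σ(M)` once the chain of images is stable, Lemma 3.16 (b)),
  `crysSupport_eq_empty_of_isNilpotent`, `crysSupport_quotient_eq` (invariance under nilpotent
  quotients, Lemma 3.16 (b)) and **`support_quotient_nil_eq_crysSupport`: `Supp(M/M_nil) =
  Supp_crys(M)` for Noetherian `M`** — the two usual descriptions of the support of the Cartier
  crystal of `M` agree.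

What is NOT here: local nilpotence for non-Noetherian `M` (Rem. 2.13); localisation of Cartier
structures (Lemma 2.3); Cartier crystals (§3).

## Sources

* [BlickleBockle2011] M. Blickle, G. Böckle, *Cartier modules: finiteness results*, J. reine
  angew. Math. 661 (2011) 85–123 = arXiv:0909.2531 (arXiv numbering, read): Def. 2.7, Lemma 2.9,
  Lemma 2.11, Prop. 2.12, Prop. 2.14, Rem. 2.16, Def. 3.15, Lemma 3.16.
-/

noncomputable section

namespace Literature.RingTheory.TightClosure

universe u v

namespace CartierModule

variable {p e : ℕ} {R : Type u} {M : Type v} [CommRing R] [AddCommGroup M] [Module R M]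

/-! ## Restriction and quotient -/

/-- The **restriction** of the Cartier structure to a Cartier submodule `N`.
[cite: BlickleBockle2011, Def. 2.1] -/
def restrict (𝒞 : CartierModule p e R M) (N : Submodule R M) (hN : 𝒞.IsSubmodule N) :
    CartierModule p e R N where
  C :=
    { toFun := fun x => ⟨𝒞.C (x : M), isSubmodule_iff.mp hN (x : M) x.2⟩
      map_zero' := Subtype.ext (map_zero 𝒞.C)
      map_add' := fun x y => Subtype.ext (map_add 𝒞.C (x : M) (y : M)) }
  map_pow_smul' r x := Subtype.ext (𝒞.map_pow_smul r (x : M))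

/-- The restricted structural map on elements. [folklore] -/
@[simp]
theorem restrict_C_apply (𝒞 : CartierModule p e R M) {N : Submodule R M} (hN : 𝒞.IsSubmodule N)
    (x : N) : ((𝒞.restrict N hN).C x : M) = 𝒞.C x :=
  rfl

/-- The **quotient** Cartier structure on `M ⧸ N` for a Cartier submodule `N` (`C` descends since
`C(N) ⊆ N`). [cite: BlickleBockle2011, Def. 2.1 (cokernels of maps of Cartier modules)] -/
def quotient (𝒞 : CartierModule p e R M) (N : Submodule R M) (hN : 𝒞.IsSubmodule N) :
    CartierModule p e R (M ⧸ N) where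
  C := QuotientAddGroup.map N.toAddSubgroup N.toAddSubgroup 𝒞.C
    fun m hm => isSubmodule_iff.mp hN m hm
  map_pow_smul' r x := by
    induction x using Submodule.Quotient.induction_on with
    | H m =>
      rw [← Submodule.Quotient.mk_smul]
      show Submodule.Quotient.mk (𝒞.C (r ^ p ^ e • m)) = r • Submodule.Quotient.mk (𝒞.C m)
      rw [𝒞.map_pow_smul, Submodule.Quotient.mk_smul]

/-- The quotient structural map on classes: `C̄ [m] = [C m]`. [folklore] -/
@[simp]
theorem quotient_C_mk (𝒞 : CartierModule p e R M) {N : Submodule R M} (hN : 𝒞.IsSubmodule N)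
    (m : M) : (𝒞.quotient N hN).C (Submodule.Quotient.mk m) = Submodule.Quotient.mk (𝒞.C m) :=
  rfl

/-- Cartier submodules of `M/N` pull back to Cartier submodules of `M`. [folklore] -/
theorem IsSubmodule.comap_mkQ {𝒞 : CartierModule p e R M} {N : Submodule R M}
    (hN : 𝒞.IsSubmodule N) {N' : Submodule R (M ⧸ N)} (h' : (𝒞.quotient N hN).IsSubmodule N') :
    𝒞.IsSubmodule (N'.comap N.mkQ) :=
  isSubmodule_iff.mpr fun m hm => isSubmodule_iff.mp h' (N.mkQ m) hm

/-- Iterated images pass to the quotient: `C̄ⁿ((N' + N)/N) = (Cⁿ(N') + N)/N`. [folklore] -/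
theorem iterImage_quotient_map (𝒞 : CartierModule p e R M) {N : Submodule R M}
    (hN : 𝒞.IsSubmodule N) (n : ℕ) (N' : Submodule R M) :
    (𝒞.quotient N hN).iterImage n (N'.map N.mkQ) = (𝒞.iterImage n N').map N.mkQ := by
  have hsc : Function.Semiconj (Submodule.Quotient.mk (p := N)) 𝒞.C (𝒞.quotient N hN).C :=
    fun _ => rfl
  ext x
  simp only [mem_iterImage_iff, Submodule.mem_map]
  constructor
  · rintro ⟨_, ⟨m, hm, rfl⟩, rfl⟩
    refine ⟨𝒞.C^[n] m, ⟨m, hm, rfl⟩, ?_⟩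
    rw [Submodule.mkQ_apply, Submodule.mkQ_apply]
    exact hsc.iterate_right n m
  · rintro ⟨_, ⟨m, hm, rfl⟩, rfl⟩
    refine ⟨N.mkQ m, ⟨m, hm, rfl⟩, ?_⟩
    rw [Submodule.mkQ_apply, Submodule.mkQ_apply]
    exact (hsc.iterate_right n m).symm

/-- Iterated images pass to the quotient: `C̄ⁿ(M/N) = (Cⁿ(M) + N)/N`. [folklore] -/
theorem iterImage_quotient_top (𝒞 : CartierModule p e R M) {N : Submodule R M}
    (hN : 𝒞.IsSubmodule N) (n : ℕ) :
    (𝒞.quotient N hN).iterImage n ⊤ = (𝒞.iterImage n ⊤).map N.mkQ := by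
  rw [← 𝒞.iterImage_quotient_map hN n ⊤, Submodule.map_top, Submodule.range_mkQ]

/-- A surjective structural map stays surjective on every quotient `M/N`.
[cite: BlickleBockle2011, §1 (idea of the proof of the Main Theorem: "the surjectivity is then
automatically true for all quotients `M/Mᵢ`")] -/
theorem IsSurjective.quotient {𝒞 : CartierModule p e R M} (h : 𝒞.IsSurjective) {N : Submodule R M}
    (hN : 𝒞.IsSubmodule N) : (𝒞.quotient N hN).IsSurjective := by
  have h1 := 𝒞.iterImage_quotient_top hN 1
  rw [iterImage_succ, iterImage_zero, iterImage_succ, iterImage_zero] at h1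
  rw [IsSurjective, h1, h, Submodule.map_top, Submodule.range_mkQ]

/-- **The quotient `M/N` is nilpotent iff `Cⁿ(M) ⊆ N` for some `n`.** [cite: BlickleBockle2011,
Def. 2.7 and Rem. 2.16] -/
theorem isNilpotent_quotient_iff (𝒞 : CartierModule p e R M) {N : Submodule R M}
    (hN : 𝒞.IsSubmodule N) : (𝒞.quotient N hN).IsNilpotent ↔ ∃ n, 𝒞.iterImage n ⊤ ≤ N := by
  refine exists_congr fun n => ?_
  rw [𝒞.iterImage_quotient_top hN, ← LinearMap.le_ker_iff_map, Submodule.ker_mkQ]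

/-! ## Sums of nilpotent Cartier submodules -/

/-- `Cⁿ(0) = 0`. [folklore] -/
theorem iterImage_bot (𝒞 : CartierModule p e R M) (n : ℕ) : 𝒞.iterImage n ⊥ = ⊥ := by
  induction n with
  | zero => rfl
  | succ n ih => rw [iterImage_succ, ih, image_bot]

/-- `Cⁿ(N ⊔ N') = Cⁿ(N) ⊔ Cⁿ(N')`. [folklore] -/
theorem iterImage_sup (𝒞 : CartierModule p e R M) (n : ℕ) (N N' : Submodule R M) :
    𝒞.iterImage n (N ⊔ N') = 𝒞.iterImage n N ⊔ 𝒞.iterImage n N' := by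
  induction n with
  | zero => rfl
  | succ n ih => rw [iterImage_succ, iterImage_succ, iterImage_succ, ih, image_sup]

/-- Submodules of nilpotent submodules are nilpotent. [cite: BlickleBockle2011, Lemma 2.11] -/
theorem IsNilpotentOn.mono {𝒞 : CartierModule p e R M} {N N' : Submodule R M}
    (h : 𝒞.IsNilpotentOn N) (hle : N' ≤ N) : 𝒞.IsNilpotentOn N' := by
  obtain ⟨n, hn⟩ := h
  exact ⟨n, eq_bot_iff.mpr ((𝒞.iterImage_mono n hle).trans hn.le)⟩

/-- **The sum of two nilpotent submodules is nilpotent** (of order `≤` the maximum of the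
orders). [cite: BlickleBockle2011, Lemma 2.9 (proof)] -/
theorem IsNilpotentOn.sup {𝒞 : CartierModule p e R M} {N N' : Submodule R M}
    (h : 𝒞.IsNilpotentOn N) (h' : 𝒞.IsNilpotentOn N') : 𝒞.IsNilpotentOn (N ⊔ N') := by
  obtain ⟨a, ha⟩ := h
  obtain ⟨b, hb⟩ := h'
  refine ⟨a + b, ?_⟩
  have h1 : 𝒞.iterImage (a + b) N = ⊥ := by rw [Nat.add_comm, iterImage_add, ha, iterImage_bot]
  have h2 : 𝒞.iterImage (a + b) N' = ⊥ := by rw [iterImage_add, hb, iterImage_bot]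
  rw [iterImage_sup, h1, h2, bot_sup_eq]

/-- **Extensions of nilpotents are nilpotent**: if `Cᵃ(N) ⊆ N'` and `Cᵇ(N') = 0` then
`Cᵇ⁺ᵃ(N) = 0`. [cite: BlickleBockle2011, Lemma 2.11] -/
theorem iterImage_add_eq_bot {𝒞 : CartierModule p e R M} {N N' : Submodule R M} {a b : ℕ}
    (h1 : 𝒞.iterImage a N ≤ N') (h2 : 𝒞.iterImage b N' = ⊥) : 𝒞.iterImage (b + a) N = ⊥ := by
  rw [iterImage_add]
  exact eq_bot_iff.mpr ((𝒞.iterImage_mono b h1).trans h2.le)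

/-! ## The nilpotent part and the crystalline support -/

/-- The **nilpotent part** `M_nil`: the sum of all nilpotent Cartier submodules of `M` (for `M`
Noetherian this is the largest nilpotent Cartier submodule and `M/M_nil` has no non-zero nilpotent
Cartier submodule, Blickle–Böckle Lemma 2.9 and Prop. 2.12). [cite: BlickleBockle2011, Prop. 2.12] -/
def nil (𝒞 : CartierModule p e R M) : Submodule R M :=
  sSup {N | 𝒞.IsSubmodule N ∧ 𝒞.IsNilpotentOn N}

/-- A nilpotent Cartier submodule lies in `M_nil`. [cite: BlickleBockle2011, Prop. 2.12] -/
theorem le_nil {𝒞 : CartierModule p e R M} {N : Submodule R M} (hN : 𝒞.IsSubmodule N)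
    (hn : 𝒞.IsNilpotentOn N) : N ≤ 𝒞.nil :=
  le_sSup ⟨hN, hn⟩

/-- `M_nil` is a Cartier submodule. [cite: BlickleBockle2011, Prop. 2.12] -/
theorem isSubmodule_nil (𝒞 : CartierModule p e R M) : 𝒞.IsSubmodule 𝒞.nil :=
  isSubmodule_sSup fun _ h => h.1

/-- **For Noetherian `M`, `M_nil` is itself a nilpotent Cartier submodule** (the largest one): a
maximal nilpotent Cartier submodule `N₀` absorbs every other one, `N ⊔ N₀ = N₀`.
[cite: BlickleBockle2011, Lemma 2.9 and Prop. 2.12 (a)] -/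
theorem isNilpotentOn_nil [IsNoetherian R M] (𝒞 : CartierModule p e R M) :
    𝒞.IsNilpotentOn 𝒞.nil := by
  set S : Set (Submodule R M) := {N | 𝒞.IsSubmodule N ∧ 𝒞.IsNilpotentOn N} with hS
  have hne : S.Nonempty := ⟨⊥, 𝒞.isSubmodule_bot, 0, rfl⟩
  obtain ⟨N₀, hN₀, hmax⟩ := set_has_maximal_iff_noetherian.mpr ‹IsNoetherian R M› S hne
  have key : 𝒞.nil = N₀ := by
    refine le_antisymm (sSup_le fun N hNS => ?_) (le_sSup hN₀)
    have hsup : N ⊔ N₀ ∈ S := ⟨IsSubmodule.sup hNS.1 hN₀.1, hNS.2.sup hN₀.2⟩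
    have heq : N₀ = N ⊔ N₀ := eq_of_le_of_not_lt le_sup_right (hmax _ hsup)
    exact le_sup_left.trans heq.ge
  rw [key]
  exact hN₀.2

/-- **`M/M_nil` has no non-zero nilpotent Cartier submodule** (Noetherian `M`): the preimage `N`
of a nilpotent Cartier submodule of `M/M_nil` is an extension of nilpotents, hence nilpotent, hence
inside `M_nil`. [cite: BlickleBockle2011, Prop. 2.12 (b)] -/
theorem eq_bot_of_isNilpotentOn_quotient_nil [IsNoetherian R M] (𝒞 : CartierModule p e R M)
    {N' : Submodule R (M ⧸ 𝒞.nil)} (h1 : (𝒞.quotient 𝒞.nil 𝒞.isSubmodule_nil).IsSubmodule N')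
    (h2 : (𝒞.quotient 𝒞.nil 𝒞.isSubmodule_nil).IsNilpotentOn N') : N' = ⊥ := by
  obtain ⟨a, ha⟩ := h2
  obtain ⟨b, hb⟩ := 𝒞.isNilpotentOn_nil
  have h3 : 𝒞.iterImage a (N'.comap 𝒞.nil.mkQ) ≤ 𝒞.nil := by
    have h4 : (𝒞.iterImage a (N'.comap 𝒞.nil.mkQ)).map 𝒞.nil.mkQ = ⊥ := by
      rw [← iterImage_quotient_map, eq_bot_iff, ← ha]
      exact iterImage_mono _ a (Submodule.map_comap_le _ _)
    rwa [← LinearMap.le_ker_iff_map, Submodule.ker_mkQ] at h4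
  have h5 : N'.comap 𝒞.nil.mkQ ≤ 𝒞.nil := le_nil (𝒞.isSubmodule_nil.comap_mkQ h1) ⟨b + a, iterImage_add_eq_bot h3 hb⟩
  rw [eq_bot_iff, ← Submodule.map_comap_eq_of_surjective (Submodule.mkQ_surjective 𝒞.nil) N']
  exact (Submodule.map_mono h5).trans (Submodule.mkQ_map_self 𝒞.nil).le

/-- The submodule `Mₙ = {m | Cⁿ(R m) = 0}` of elements generating a submodule killed by `Cⁿ`
(Blickle–Böckle: "let `Mₑ` be the subsheaf whose sections are precisely the sections `m` such that
`Cᵉ(𝒪_X · m) = 0`; each `Mₑ` is a nilpotent Cartier submodule, and any nilpotent Cartier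
submodule of order `e` is contained in `Mₑ`"). [cite: BlickleBockle2011, §2.2 (footnote to Def. 2.7)] -/
def kerIterate (𝒞 : CartierModule p e R M) (n : ℕ) : Submodule R M where
  carrier := {m | ∀ r : R, 𝒞.C^[n] (r • m) = 0}
  zero_mem' r := by rw [smul_zero, iterate_map_zero]
  add_mem' {a b} ha hb r := by rw [smul_add, iterate_map_add, ha r, hb r, add_zero]
  smul_mem' a m hm r := by
    show 𝒞.C^[n] (r • a • m) = 0
    rw [smul_smul]
    exact hm (r * a)

/-- Membership in `Mₙ`. [folklore] -/
theorem mem_kerIterate_iff {𝒞 : CartierModule p e R M} {n : ℕ} {m : M} :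
    m ∈ 𝒞.kerIterate n ↔ ∀ r : R, 𝒞.C^[n] (r • m) = 0 :=
  Iff.rfl

/-- `Mₙ` is a Cartier submodule (`r C(m) = C(r^q m)`). [cite: BlickleBockle2011, §2.2 (footnote to
Def. 2.7)] -/
theorem isSubmodule_kerIterate (𝒞 : CartierModule p e R M) (n : ℕ) :
    𝒞.IsSubmodule (𝒞.kerIterate n) :=
  isSubmodule_iff.mpr fun m hm r => by
    rw [← 𝒞.map_pow_smul, ← Function.iterate_succ_apply, Function.iterate_succ_apply', hm, map_zero]

/-- `Cⁿ(Mₙ) = 0`: `Mₙ` is nilpotent of order `≤ n`. [cite: BlickleBockle2011, §2.2 (footnote to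
Def. 2.7)] -/
theorem iterImage_kerIterate (𝒞 : CartierModule p e R M) (n : ℕ) :
    𝒞.iterImage n (𝒞.kerIterate n) = ⊥ :=
  eq_bot_iff.mpr fun y hy => by
    obtain ⟨m, hm, rfl⟩ := mem_iterImage_iff.mp hy
    have h := mem_kerIterate_iff.mp hm 1
    rw [one_smul] at h
    rw [h]
    exact Submodule.zero_mem _

/-- A submodule `N` with `Cⁿ(N) = 0` (e.g. a nilpotent Cartier submodule of order `≤ n`) lies in
`Mₙ`. [cite: BlickleBockle2011, §2.2 (footnote to Def. 2.7)] -/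
theorem le_kerIterate {𝒞 : CartierModule p e R M} {N : Submodule R M} {n : ℕ}
    (hn : 𝒞.iterImage n N = ⊥) : N ≤ 𝒞.kerIterate n := fun m hm r =>
  (Submodule.mem_bot R).mp (hn.le (mem_iterImage_iff.mpr ⟨r • m, N.smul_mem r hm, rfl⟩))

/-- **`M_nil = ⋃ₙ Mₙ`.** [cite: BlickleBockle2011, §2.2 (footnote to Def. 2.7); Prop. 2.12] -/
theorem nil_eq_iSup_kerIterate (𝒞 : CartierModule p e R M) : 𝒞.nil = ⨆ n, 𝒞.kerIterate n := by
  refine le_antisymm (sSup_le fun N hN => ?_)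
    (iSup_le fun n => le_nil (𝒞.isSubmodule_kerIterate n) ⟨n, 𝒞.iterImage_kerIterate n⟩)
  obtain ⟨n, hn⟩ := hN.2
  exact (le_kerIterate hn).trans (le_iSup _ n)

/-! ## The crystalline support -/

/-- The **crystalline support** `Supp_crys(M) = ⋂ₙ Supp(Cⁿ(M))`: the primes `x` of `R` such that
no iterated image `Cⁿ(M)` vanishes at `x`, i.e. (as `(Cⁿ M)_x = Cⁿ(M_x)`) such that the localised
Cartier module `M_x` is not nilpotent. [cite: BlickleBockle2011, Def. 3.15] -/
def crysSupport (𝒞 : CartierModule p e R M) : Set (PrimeSpectrum R) :=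
  ⋂ n, Module.support R (𝒞.iterImage n ⊤)

/-- Membership in the crystalline support. [cite: BlickleBockle2011, Def. 3.15] -/
theorem mem_crysSupport_iff {𝒞 : CartierModule p e R M} {x : PrimeSpectrum R} :
    x ∈ 𝒞.crysSupport ↔ ∀ n, x ∈ Module.support R (𝒞.iterImage n ⊤) :=
  Set.mem_iInter

/-- The supports of the iterated images decrease. [cite: BlickleBockle2011, Prop. 2.14] -/
theorem support_iterImage_antitone (𝒞 : CartierModule p e R M) :
    Antitone fun n => Module.support R (𝒞.iterImage n ⊤) :=
  fun _ _ h => Module.support_subset_of_injective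
    (Submodule.inclusion (iterImage_antitone 𝒞.isSubmodule_top h))
    (Submodule.inclusion_injective _)

/-- `Supp_crys(M) ⊆ Supp(M)`. [cite: BlickleBockle2011, Lemma 3.16] -/
theorem crysSupport_subset_support (𝒞 : CartierModule p e R M) :
    𝒞.crysSupport ⊆ Module.support R M :=
  (Set.iInter_subset _ 0).trans (Submodule.topEquiv.support_eq).le

/-- If the chain of images is constant from `n₀` on, `Supp_crys(M) = Supp(Cⁿ⁰(M)) = Supp(σ(M))`.
[cite: BlickleBockle2011, Lemma 3.16 (b)] -/
theorem crysSupport_eq_of_stable {𝒞 : CartierModule p e R M} {n₀ : ℕ}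
    (h : 𝒞.iterImage (n₀ + 1) ⊤ = 𝒞.iterImage n₀ ⊤) :
    𝒞.crysSupport = Module.support R (𝒞.iterImage n₀ ⊤) := by
  refine Set.Subset.antisymm (Set.iInter_subset _ n₀) (Set.subset_iInter fun n => ?_)
  rcases le_total n₀ n with hn | hn
  · rw [iterImage_eq_of_stable h hn]
  · exact 𝒞.support_iterImage_antitone hn

/-- For a surjective structural map, `Supp_crys(M) = Supp(M)`. [cite: BlickleBockle2011,
Lemma 3.16 (a)] -/
theorem crysSupport_eq_support {𝒞 : CartierModule p e R M} (h : 𝒞.IsSurjective) :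
    𝒞.crysSupport = Module.support R M := by
  rw [crysSupport_eq_of_stable (n₀ := 0) (by rw [h.iterImage_top, h.iterImage_top]),
    iterImage_zero]
  exact Submodule.topEquiv.support_eq

/-- A nilpotent Cartier module has empty crystalline support. [cite: BlickleBockle2011,
Def. 3.15] -/
theorem crysSupport_eq_empty_of_isNilpotent {𝒞 : CartierModule p e R M} (h : 𝒞.IsNilpotent) :
    𝒞.crysSupport = ∅ := by
  obtain ⟨n, hn⟩ := h
  refine Set.eq_empty_of_subset_empty fun x hx => ?_
  have hx := mem_crysSupport_iff.mp hx n
  rw [hn, Module.support_eq_empty] at hx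
  exact hx

/-! ## `Supp(M/M_nil)` is the crystalline support -/

/-- **The crystalline support is invariant under nilpotent quotients**: for a nilpotent Cartier
submodule `V`, `Supp_crys(M/V) = Supp_crys(M)` (`⊆`: `C̄ⁿ(M/V)` is a quotient of `Cⁿ(M)`; `⊇`: if
`s Cⁿ(M) ⊆ V` locally with `Cᵇ(V) = 0`, then `s Cᵇ⁺ⁿ(M) = Cᵇ(s^(q^b) Cⁿ(M)) = 0`).
[cite: BlickleBockle2011, Lemma 3.16 (b)] -/
theorem crysSupport_quotient_eq [ExpChar R p] (𝒞 : CartierModule p e R M) {V : Submodule R M}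
    (hV : 𝒞.IsSubmodule V) (hVn : 𝒞.IsNilpotentOn V) :
    (𝒞.quotient V hV).crysSupport = 𝒞.crysSupport := by
  obtain ⟨b, hb⟩ := hVn
  refine Set.Subset.antisymm (Set.iInter_mono fun n => ?_) fun x hx => ?_
  · rw [iterImage_quotient_top]
    exact Module.support_subset_of_surjective _ (LinearMap.submoduleMap_surjective V.mkQ _)
  · rw [mem_crysSupport_iff] at hx ⊢
    intro n
    by_contra hxn
    refine absurd (hx (b + n)) (Module.notMem_support_iff'.mpr fun w => ?_)
    obtain ⟨y, hy⟩ := w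
    rw [iterImage_add] at hy
    obtain ⟨m, hm, rfl⟩ := mem_iterImage_iff.mp hy
    rw [iterImage_quotient_top] at hxn
    obtain ⟨r, hr, hr0⟩ := Module.notMem_support_iff'.mp hxn ⟨V.mkQ m, Submodule.mem_map_of_mem hm⟩
    refine ⟨r, hr, Subtype.ext ?_⟩
    have hrm : r • m ∈ V := by
      rw [← Submodule.Quotient.mk_eq_zero, Submodule.Quotient.mk_smul]
      exact congr_arg Subtype.val hr0
    have hk : r ^ p ^ (e * b) • m ∈ V := by
      rw [← Nat.sub_add_cancel (expChar_pow_pos R p (e * b)), pow_succ, mul_smul]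
      exact V.smul_mem _ hrm
    show r • 𝒞.C^[b] m = 0
    rw [← 𝒞.iterate_map_pow_smul]
    exact (Submodule.mem_bot R).mp (hb.le (mem_iterImage_iff.mpr ⟨_, hk, rfl⟩))

/-- **`Supp(M/M_nil) = Supp_crys(M)` for Noetherian `M`**: the two descriptions of the support of
the Cartier crystal of `M` agree. `⊇` is `Supp_crys(M) = Supp_crys(M/M_nil) ⊆ Supp(M/M_nil)`; for
`⊆`, if `x ∈ Supp(M/M_nil)` but `s C̄ᴺ(M/M_nil) = 0` for some `s ∉ x`, then for `v` with `v_x ≠ 0`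
the element `s^(q^N) v ≠ 0` generates a submodule killed by `C̄ᴺ`, a non-zero nilpotent Cartier
submodule of `M/M_nil` — contradicting Prop. 2.12 (b). [cite: BlickleBockle2011, Def. 3.15,
Lemma 3.16, Prop. 2.12] -/
theorem support_quotient_nil_eq_crysSupport [ExpChar R p] [IsNoetherian R M]
    (𝒞 : CartierModule p e R M) : Module.support R (M ⧸ 𝒞.nil) = 𝒞.crysSupport := by
  set Q := 𝒞.quotient 𝒞.nil 𝒞.isSubmodule_nil
  rw [← 𝒞.crysSupport_quotient_eq 𝒞.isSubmodule_nil 𝒞.isNilpotentOn_nil]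
  refine Set.Subset.antisymm (fun x hx => ?_) Q.crysSupport_subset_support
  rw [mem_crysSupport_iff]
  intro N
  by_contra hxN
  rw [Module.mem_support_iff_of_finite, SetLike.not_le_iff_exists] at hxN
  obtain ⟨s, hs, hsx⟩ := hxN
  obtain ⟨v, hv⟩ := Module.mem_support_iff'.mp hx
  have hk : s ^ p ^ (e * N) ∉ x.asIdeal := fun h => hsx (x.isPrime.mem_of_pow_mem _ h)
  have hw : s ^ p ^ (e * N) • v ∈ Q.kerIterate N := fun r => by
    rw [smul_smul, mul_comm, mul_smul, Q.iterate_map_pow_smul]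
    have h0 := Module.mem_annihilator.mp hs ⟨_, mem_iterImage_iff.mpr ⟨r • v, trivial, rfl⟩⟩
    exact congr_arg Subtype.val h0
  have hnil : Q.nil = ⊥ :=
    𝒞.eq_bot_of_isNilpotentOn_quotient_nil Q.isSubmodule_nil Q.isNilpotentOn_nil
  have h0 : s ^ p ^ (e * N) • v = 0 := by
    have h := le_nil (Q.isSubmodule_kerIterate N) ⟨N, Q.iterImage_kerIterate N⟩ hw
    rwa [hnil, Submodule.mem_bot] at h
  exact hv _ hk h0

end CartierModule

end Literature.RingTheory.TightClosure

end
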